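import Summits.BirchSwinnertonDyer.BirchSwinnertonDyer.Theorems.ErratumRoadFiveNonSurjCornerKolyJProp44H44Zhang
import HarnessLib

/-!
# McCallum 1991 Prop. 4.4 at `λ ∣ m` in ORDER form («h44») at ZHANG–Kolyvagin levels — the END of
# x11b3's `h44` programme re-typed with a PAIR guard `R m ℓ` (cell `bsd-stepL`, seat `bsd-stepL-corner-p1`
# g10; `--supports stmt-BirchSwinnertonDyer-19947`; memo CORNER-G9 §5 step (2), CORNER-G10 §1)

WHY/WHAT. `Prop44.h44_of_prop37_of_ringClassDecomposition_on_zhang` (p532737, this seat g9) is x11b3's END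
`KolyvaginH44.h44_of_prop37_of_ringClassDecomposition_on` at Zhang–Kolyvagin levels (antecedent
`Zhang2014.IsKolyvaginPrime (W.conductorNorm ℤ) W K p q ∧ M ≤ kolyvaginIndex W p q`, image-free) with a LEVEL guard
`R m` on its labelled inputs `h37` ∕ `hsplit` ∕ `hram`. Its proof reads those inputs ONLY at the conclusion's own
pair `(m, ℓ)`. The corner's consumers (the walk's `h47`, the swap's `h44c`; bsd-jet ∕ tam3 currency) hold TWO
compatible Kolyvagin–Heegner data, at `m` and at `m·ℓ`, and nothing at the other divisors — so they can supply
`h37` (Gross Prop. 3.7 with the inter-level lift) at the ONE pair `(m·ℓ, ℓ)` only. Here the same END with a PAIR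
guard `R : ℕ → ℕ → Prop`: `h37`, `hsplit`, `hram` are assumed at the pairs `(m, ℓ)` with `R m ℓ` and the `h44`
clause is concluded at exactly those pairs; proof VERBATIM p532737 (the guard threaded). Instances:
`R m ℓ := R₀ m` (the level-guarded END), `R m ℓ := (m = m₀ ∧ ℓ = ℓ₀)` (one pair). HONEST FRAMING: a re-typing;
`h37` ∕ `hsplit` ∕ `hram` remain labelled hypotheses here (suppliers: `…Prop44SuppliersZhang`); nothing about
BSD; no stub closes; T7.
References: [McCallumLMS1991] Prop. 4.4, Lemma 4.3, §4 (p. 301); [GrossLMS1991] Prop. 3.7, Prop. 6.2 (2), §3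
(3.1)–(3.4); [WZhang2014] Notations (xii).
-/

set_option autoImplicit false
set_option linter.dupNamespace false

noncomputable section

open scoped Classical Pointwise
open WeierstrassCurve Field NumberField IsDedekindDomain Finset
open Literature.NumberTheory.EllipticCurves Literature.NumberTheory.GaloisRepresentations
open Literature.NumberTheory.EllipticCurves.KolyvaginCocycle
open Literature.NumberTheory.EllipticCurves.KolyvaginEuler
open Rat.HeightOneSpectrum
open Summit.BirchSwinnertonDyer.Rank1Residual.X11b.KolyvaginH44

namespace Summit.BirchSwinnertonDyer.BirchSwinnertonDyer.Theorems.Prop44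

-- `K : Type`: the JET ∕ Method2 bricks are universe `0`.
variable {K : Type} [Field K] [NumberField K]

/-! ## `h44` from Gross's Prop. 3.7 and the ring-class decomposition at `λ` -/

/-- **McCallum Prop. 4.4 at `λ ∣ m` in order form («h44»), at the ZHANG–Kolyvagin PAIRS `(m, ℓ)` guarded by
`R m ℓ`** — `h44_of_prop37_of_ringClassDecomposition_on_zhang` (p532737) with its labelled inputs `h37` (Gross Prop.
3.7 (1)(2) with the inter-level lift), `hsplit` (`λ` splits completely in `K_{m/ℓ}`), `hram` (total ramification:
`σ_ℓ` is induced by inertia, which acts through its powers) assumed only at the pairs with `R m ℓ`, and the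
conclusion — for every `a`, `p^a c_M(m) ∈ Sel_λ ↔ p^a c_M(m/ℓ)_λ = 0` — at exactly those pairs (module docstring).
[cite: McCallumLMS1991, Prop. 4.4, Lemma 4.3] [cite: GrossLMS1991, Prop. 3.7, Prop. 6.2 (2)] [cite: WZhang2014, Notations (xii)] -/
theorem h44_of_prop37_of_ringClassDecomposition_at_zhang {W : WeierstrassCurve ℚ}
    [W.IsElliptic] [W.IsGloballyMinimal] (hK : IsImaginaryQuadratic K)
    {p M : ℕ} (hp : p.Prime) (hp2 : p ≠ 2) (hM : 1 ≤ M)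
    (hdiv : ∀ Q : geomPoints (W.baseChange K), ∃ R, ((p ^ M : ℕ) : ℤ) • R = Q)
    {𝒢 : ℕ → Type*} [∀ m, CommGroup (𝒢 m)] {A₀ : ℕ → Type*} [∀ m, AddCommGroup (A₀ m)]
    [∀ m, DistribMulAction (𝒢 m) (A₀ m)]
    (σ : ∀ m, ℕ → 𝒢 m) (L : ℕ → Finset ℕ) (H : ∀ m, Subgroup (𝒢 m))
    [∀ m, Fintype (𝒢 m ⧸ H m)] (f : ∀ m, 𝒢 m ⧸ H m → 𝒢 m)
    (hord : ∀ m, ∀ ℓ ∈ L m, σ m ℓ ^ (ℓ + 1) = 1)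
    (y : ∀ m, A₀ m)
    (π : ∀ m, absoluteGaloisGroup K →* 𝒢 m) (j : ∀ m, A₀ m →+ geomPoints (W.baseChange K))
    (hj : ∀ m (g : absoluteGaloisGroup K) (a : A₀ m), j m (π m g • a) = g • j m a)
    (hA : ∀ m, IsAdmissible (absoluteGaloisGroup K) (j m).range ((p ^ M : ℕ) : ℤ))
    (hPt : ∀ m, j m (kolyvaginPoint (σ m) (L m) (f m) (y m)) ∈
      invPoints (absoluteGaloisGroup K) (j m).range ((p ^ M : ℕ) : ℤ))
    (hI : ∀ m : ℕ, ∀ v : HeightOneSpectrum (𝓞 K), (m : 𝓞 K) ∉ v.asIdeal →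
      ∀ 𝔐 ∈ v.localPrimesAbove, ∀ t ∈ 𝔐.inertia (absoluteGaloisGroup (v.adicCompletion K)),
        resGal (K := K) (v.adicCompletion K) t • j m (kolyvaginPoint (σ m) (L m) (f m) (y m)) =
          j m (kolyvaginPoint (σ m) (L m) (f m) (y m)))
    (R : ℕ → ℕ → Prop)
    (h37 : ∀ m : ℕ, Squarefree m →
      (∀ q ∈ m.primeFactors, Zhang2014.IsKolyvaginPrime (W.conductorNorm ℤ) W K p q ∧
        M ≤ Zhang2014.kolyvaginIndex W p q) →
      ∀ ℓ : ℕ, ℓ.Prime → ℓ ∣ m → R m ℓ →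
      ℓ ∈ L m ∧ ∃ y' : A₀ m,
        j m (kolyvaginPoint (σ m) ((L m).erase ℓ) (f m) y') =
          j (m / ℓ) (kolyvaginPoint (σ (m / ℓ)) (L (m / ℓ)) (f (m / ℓ)) (y (m / ℓ))) ∧
        grAct (A₀ m) (traceElt (σ m ℓ) ℓ) (y m) = W.frobeniusTrace ℓ • y' ∧
        ∀ [Fact ℓ.Prime] (hΔ : ¬ (ℓ : ℤ) ∣ minimalDiscriminantInt W)
          (φ₀ : absoluteGaloisGroup (ZMod ℓ)), (∀ x : AlgebraicClosure (ZMod ℓ), φ₀ • x = x ^ ℓ) →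
          ∀ γ : 𝒢 m, geomReduction hΔ ((RatClosure.pointsEquiv (K := K) W).symm (j m (γ • y m))) =
            φ₀ • geomReduction hΔ ((RatClosure.pointsEquiv (K := K) W).symm (j m (γ • y'))))
    (hsplit : ∀ m : ℕ, Squarefree m →
      (∀ q ∈ m.primeFactors, Zhang2014.IsKolyvaginPrime (W.conductorNorm ℤ) W K p q ∧
        M ≤ Zhang2014.kolyvaginIndex W p q) →
      ∀ ℓ : ℕ, ℓ.Prime → ℓ ∣ m → R m ℓ → ∀ v : HeightOneSpectrum (𝓞 K), (ℓ : 𝓞 K) ∈ v.asIdeal →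
      ∀ 𝔓 ∈ v.primesAbove, ∀ F : absoluteGaloisGroup K, IsArithFrobAt (𝓞 K) F 𝔓 →
        F • j (m / ℓ) (kolyvaginPoint (σ (m / ℓ)) (L (m / ℓ)) (f (m / ℓ)) (y (m / ℓ))) =
          j (m / ℓ) (kolyvaginPoint (σ (m / ℓ)) (L (m / ℓ)) (f (m / ℓ)) (y (m / ℓ))))
    (hram : ∀ m : ℕ, Squarefree m →
      (∀ q ∈ m.primeFactors, Zhang2014.IsKolyvaginPrime (W.conductorNorm ℤ) W K p q ∧
        M ≤ Zhang2014.kolyvaginIndex W p q) →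
      ∀ ℓ : ℕ, ℓ.Prime → ℓ ∣ m → R m ℓ → ∀ v : HeightOneSpectrum (𝓞 K), (ℓ : 𝓞 K) ∈ v.asIdeal →
      ∀ 𝔓 ∈ v.primesAbove, ∃ τ₀ ∈ 𝔓.inertia (absoluteGaloisGroup K), π m τ₀ = σ m ℓ ∧
        ∀ τ ∈ 𝔓.inertia (absoluteGaloisGroup K), ∃ i : ℕ, ∀ x ∈ (j m).range,
          τ • x = (τ₀ ^ i) • x) :
    ∀ m : ℕ, Squarefree m →
      (∀ q ∈ m.primeFactors, Zhang2014.IsKolyvaginPrime (W.conductorNorm ℤ) W K p q ∧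
        M ≤ Zhang2014.kolyvaginIndex W p q) →
      ∀ ℓ : ℕ, ℓ.Prime → ℓ ∣ m → R m ℓ → ∀ v : HeightOneSpectrum (𝓞 K), (ℓ : 𝓞 K) ∈ v.asIdeal →
        ∀ a : ℕ, (((p : ℤ) ^ a) • kolyvaginClass (W.baseChange K) _ hdiv (hA m)
              (j m (kolyvaginPoint (σ m) (L m) (f m) (y m))) (hPt m) ∈
            selmerLocalKer (W.baseChange K) (v.adicCompletion K) ((p ^ M : ℕ) : ℤ) ↔
          ((p : ℤ) ^ a) • kolyvaginClass (W.baseChange K) _ hdiv (hA (m / ℓ))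
              (j (m / ℓ) (kolyvaginPoint (σ (m / ℓ)) (L (m / ℓ)) (f (m / ℓ)) (y (m / ℓ))))
              (hPt (m / ℓ)) ∈
            (W.baseChange K).torsionLocalKer (v.adicCompletion K) ((p ^ M : ℕ) : ℤ)) := by
  intro m hm hkol ℓ hℓp hℓm hRm v hv a
  have hm0 : m ≠ 0 := Squarefree.ne_zero hm
  have hℓmem : ℓ ∈ m.primeFactors := Nat.mem_primeFactors.mpr ⟨hℓp, hℓm, hm0⟩
  obtain ⟨hℓ, hℓM⟩ := hkol ℓ hℓmem
  haveI : Fact ℓ.Prime := ⟨hℓp⟩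
  haveI : Fact p.Prime := ⟨hp⟩
  have huniq : ∀ w : HeightOneSpectrum (𝓞 K), (ℓ : 𝓞 K) ∈ w.asIdeal → w = v := fun w hw ↦
    Summit.BirchSwinnertonDyer.Rank1Residual.JET.RingClassTransverse.eq_of_natCast_mem_of_isPrime_span K hℓp
      hℓ.2.2.2.2.1 v w hv hw
  have hpℓ : p ≠ ℓ := fun h ↦ hℓ.2.2.2.1 h.symm
  have hℓpM : ¬ ℓ ∣ p ^ M := fun h ↦
    hpℓ ((Nat.prime_dvd_prime_iff_eq hℓp hp).mp (hℓp.dvd_of_dvd_pow h)).symm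
  have hpM0 : p ^ M ≠ 0 := pow_ne_zero M hp.ne_zero
  -- good reduction at `λ` and at the place `v₀ = (ℓ)` of `ℚ`; `ℓ ∤ Δ_W`
  have hgood : (W.baseChange K).HasGoodReductionAt v :=
    (Summit.BirchSwinnertonDyer.Rank1Residual.JET.RingClassTransverse.hasGoodReductionAt_of_zhangKolyvagin
      W K hp hℓ v hv M).1
  obtain ⟨v₀, hv₀, hℓv₀⟩ := exists_ratPlace ℓ
  have hgood₀ : W.HasGoodReductionAt v₀ :=
    Summit.BirchSwinnertonDyer.Rank1Residual.X11b.Three.Koly.Method2.LocalFrob.hasGoodReductionAt_rat_of_not_dvd_conductorNorm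
      W hℓp hℓ.2.1 v₀ hℓv₀
  have hΔ : ¬ (ℓ : ℤ) ∣ minimalDiscriminantInt W := by
    have h1 := (hasGoodReductionAtPrime_iff_hasGoodReductionAt_ringOfIntegers v₀ W).mpr hgood₀
    have h2 := @not_dvd_minimalDiscriminantInt_of_hasGoodReductionAtPrime' W _
      (primesEquiv v₀ : ℕ) (Fact.mk (primesEquiv v₀).2) h1
    rwa [hv₀] at h2
  -- `p^M ∣ ℓ + 1`, `p^M ∣ a_ℓ` (Zhang's index)
  obtain ⟨hl1, haℓ⟩ := Zhang2014.le_kolyvaginIndex_iff.mp hℓM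
  obtain ⟨l'n, hl'n⟩ := hl1
  have hl' : ((ℓ + 1 : ℕ) : ℤ) = (p : ℤ) ^ M * (l'n : ℤ) := by rw [hl'n]; push_cast; ring
  set l' : ℤ := (l'n : ℤ) with hl'def
  have haℓ' : ((p : ℤ) ^ M) ∣ W.frobeniusTrace ℓ := by exact_mod_cast haℓ
  obtain ⟨a', ha'⟩ := haℓ'
  have hpl : p ∣ ℓ + 1 := by
    have : (p : ℤ) ∣ ((ℓ + 1 : ℕ) : ℤ) := by
      rw [hl']; exact Dvd.dvd.mul_right (dvd_pow_self (p : ℤ) (by omega)) l'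
    exact_mod_cast this
  have hpa : (p : ℤ) ∣ W.frobeniusTrace ℓ := by
    rw [ha']; exact Dvd.dvd.mul_right (dvd_pow_self (p : ℤ) (by omega)) a'
  -- the inert place: uniqueness and `q_λ = ℓ²`
  have hres : v.residueCard = ℓ ^ 2 := residueCard_eq_sq_of_isPrime_span hK hℓp hℓ.2.2.2.2.1 v hv
  -- the Frobenius of `𝔽̄_ℓ`
  obtain ⟨φ₀, hφ₀'⟩ := exists_frobenius_absoluteGaloisGroup (ZMod ℓ)
  have hφ₀ : ∀ x : AlgebraicClosure (ZMod ℓ), φ₀ • x = x ^ ℓ := fun x ↦ by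
    rw [hφ₀' x, Nat.card_zmod]
  -- Prop. 3.7 at `(m, ℓ)` and the inter-level lift
  obtain ⟨hℓL, y', hy'P, hrel, hES⟩ := h37 m hm hkol ℓ hℓp hℓm hRm
  -- the Selmer condition of `c_M(m/ℓ)` at the good place `λ ∤ m/ℓ` (McCallum Lemma 4.3)
  have hmv : ((m / ℓ : ℕ) : 𝓞 K) ∉ v.asIdeal := by
    intro h
    have hdvd : ℓ ∣ m / ℓ := by
      haveI := v.isPrime
      have hw : v.asIdeal.under (𝓞 ℚ) = v₀.asIdeal := Rat.under_eq_asIdeal_of_natCast_mem hℓp hℓv₀ hv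
      have hk' : ((m / ℓ : ℕ) : 𝓞 ℚ) ∈ v.asIdeal.under (𝓞 ℚ) := by
        rw [Ideal.under_def, Ideal.mem_comap, map_natCast]; exact h
      rw [hw, Rat.natCast_mem_asIdeal_iff] at hk'
      rwa [show natGenerator v₀ = ℓ from hv₀] at hk'
    have : ℓ * ℓ ∣ m := by
      have := Nat.mul_dvd_mul_left ℓ hdvd
      rwa [Nat.mul_div_cancel' hℓm] at this
    exact hℓp.one_lt.ne' (Nat.isUnit_iff.mp (hm ℓ this))
  obtain ⟨𝔐, h𝔐⟩ := v.localPrimesAbove_nonempty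
  have hsel₂ := Summit.BirchSwinnertonDyer.Rank1Residual.X11b.Three.GrossBadPlace.kolyvaginClass_mem_selmerLocalKer_of_inertia_of_hasGoodReductionAt
    (W.baseChange K)
    (hdiv := hdiv) (hA (m / ℓ)) (hPt (m / ℓ)) v hgood h𝔐 (hI (m / ℓ) v hmv 𝔐 h𝔐)
  -- McCallum Prop. 4.4 in order form, from the reduction datum
  refine zsmul_kolyvaginClass_mem_selmerLocalKer_iff_of_le_kolyvaginIndex W hK hp hp2 hℓ hℓM hv
    (hA m) (hA (m / ℓ)) (hPt m) (hPt (m / ℓ)) hsel₂ (a := W.frobeniusTrace ℓ) hl' ha' ?_ _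
  intro 𝔓 h𝔓 F hF hFfix
  refine ⟨hsplit m hm hkol ℓ hℓp hℓm hRm v hv 𝔓 h𝔓 F hF, ?_⟩
  obtain ⟨g, red, φ, hredg, hφ, hredI, hredF, hred, hBn, htors, hchar, hcyc⟩ :=
    exists_reductionDatum_of_not_dvd_conductorNorm hΔ hp2 hpℓ hℓ.2.1 hpl hpa hφ₀ hv huniq hres h𝔓 hℓpM hpM0 hF
      hFfix
  obtain ⟨τ₀, hτ₀I, hπτ₀, hIτ₀⟩ := hram m hm hkol ℓ hℓp hℓm hRm v hv 𝔓 h𝔓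
  -- Prop. 3.7 (2) for the reduction along `𝔓`
  have hES' : ∀ γ : 𝒢 m, red (j m (γ • y m)) = φ (red (j m (γ • y'))) := by
    intro γ
    rw [hredg, hredg, hφ, ← hj, ← hj, ← mul_smul, ← mul_smul]
    exact hES hΔ φ₀ hφ₀ _
  -- the Euler-system root at `λ`
  have hlZ : ((ℓ + 1 : ℕ) : ℤ) = ((p ^ M : ℕ) : ℤ) * l' := by rw [hl']; push_cast; ring
  have haZ : W.frobeniusTrace ℓ = ((p ^ M : ℕ) : ℤ) * a' := by rw [ha']; push_cast; ring
  obtain ⟨R₀, hR₀A, hR₀, hR₀red⟩ := exists_root_of_relation (π m) (j m) (hj m) hℓL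
    (hord m ℓ hℓL) (f m) hrel hlZ haZ hπτ₀ red φ hES'
  rw [hy'P] at hR₀red
  -- lift `B = Ẽ(𝔽̄_ℓ)` to the universe of `K`
  set e : ULift.{0} (reductionModPrime W ℓ).geomPoints ≃+ (reductionModPrime W ℓ).geomPoints :=
    AddEquiv.ulift with he
  set redL : geomPoints (W.baseChange K) →+ ULift.{0} (reductionModPrime W ℓ).geomPoints :=
    e.symm.toAddMonoidHom.comp red with hredLdef
  set φL : ULift.{0} (reductionModPrime W ℓ).geomPoints →+
      ULift.{0} (reductionModPrime W ℓ).geomPoints :=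
    e.symm.toAddMonoidHom.comp (φ.comp e.toAddMonoidHom) with hφLdef
  have hredL : ∀ x, redL x = e.symm (red x) := fun _ ↦ rfl
  have hφL : ∀ b, φL b = e.symm (φ (e b)) := fun _ ↦ rfl
  refine ⟨ULift.{0} (reductionModPrime W ℓ).geomPoints, inferInstance, redL, φL, τ₀, R₀, ?_, ?_, ?_,
    ?_, ?_, ?_, ?_, hτ₀I, hIτ₀, hR₀A, hR₀, ?_⟩
  · intro τ hτ x
    rw [hredL, hredL, hredI τ hτ x]
  · intro x
    rw [hredL, hφL, hφL, hredL, AddEquiv.apply_symm_apply, AddEquiv.apply_symm_apply, hredF x]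
  · intro x hx h0
    rw [hredL, AddEquiv.map_eq_zero_iff] at h0
    exact hred x hx h0
  · intro b hb
    have hb' : (((p ^ M : ℕ) : ℤ)) • e b = 0 := by rw [← map_zsmul, hb, map_zero]
    rw [hφL, hφL, AddEquiv.apply_symm_apply, hBn _ hb', AddEquiv.symm_apply_apply]
  · intro b hb
    have hb' : φ (φ (e b)) = e b := by
      have := congrArg e hb
      rwa [hφL, hφL, AddEquiv.apply_symm_apply, AddEquiv.apply_symm_apply] at this
    have h := e.symm.toAddMonoidHom.isOfFinAddOrder (htors _ hb')
    rwa [AddEquiv.coe_toAddMonoidHom, AddEquiv.symm_apply_apply] at h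
  · intro b hb
    have hb' : φ (φ (e b)) = e b := by
      have := congrArg e hb
      rwa [hφL, hφL, AddEquiv.apply_symm_apply, AddEquiv.apply_symm_apply] at this
    apply e.injective
    rw [map_zsmul, map_zsmul, hφL, AddEquiv.apply_symm_apply]
    exact hchar _ hb'
  · intro s hs
    obtain ⟨g₁, e₁, hg₁, hord₁, hdvd₁, hndvd₁, hgen₁⟩ := hcyc s hs
    refine ⟨e.symm g₁, e₁, ?_, ?_, hdvd₁, hndvd₁, fun c hc hck ↦ ?_⟩
    · rw [hφL, AddEquiv.apply_symm_apply, hg₁, map_zsmul]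
    · rw [← hord₁]
      exact addOrderOf_injective e.symm.toAddMonoidHom e.symm.injective g₁
    · have hc' : φ (e c) = s • e c := by
        have := congrArg e hc
        rwa [hφL, AddEquiv.apply_symm_apply, map_zsmul] at this
      obtain ⟨k, hk⟩ := hck
      obtain ⟨i, hi⟩ := hgen₁ (e c) hc' ⟨k, by rw [← map_zsmul, hk, map_zero]⟩
      refine ⟨i, e.injective ?_⟩
      rw [hi, map_zsmul, AddEquiv.apply_symm_apply]
  · rw [hredL, hredL, hφL, AddEquiv.apply_symm_apply, hR₀red, map_sub, map_zsmul, map_zsmul]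


end Summit.BirchSwinnertonDyer.BirchSwinnertonDyer.Theorems.Prop44

end
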